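import Literature.MathematicalPhysics.QuantumFieldTheory.Balaban1983to89.B11Eq88KernelColumnsCompositeTwoBackgrounds
import Literature.MathematicalPhysics.QuantumFieldTheory.Balaban1983to89.B9Eq3133H1kPiTwoBackgroundOneBlockColumn
import Literature.MathematicalPhysics.QuantumFieldTheory.Balaban1983to89.B11Eq88LaplaceH1CurrentTwoBackgroundOneBlockColumn
import Literature.MathematicalPhysics.QuantumFieldTheory.Balaban1983to89.B11Eq44CKernelTowerTwoBackgrounds
import Literature.MathematicalPhysics.QuantumFieldTheory.Balaban1983to89.B11Ineq88KernelLettersFlatChain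
import Literature.MathematicalPhysics.QuantumFieldTheory.Balaban1983to89.B11Ineq73KernelLettersLatticeFree
import Literature.MathematicalPhysics.QuantumFieldTheory.Balaban1983to89.B7Eq43AveragedSmallnessLevelFree

/-!
# `Balaban1983to89.B11Ineq88KernelColumnsTwoBackgroundLatticeFree` — T. Bałaban, *The variational problem and background fields in renormalization group method
# for lattice gauge theories*, Commun. Math. Phys. **102** (1985) 277–309 [Balaban1985Variational] (68)–(73) pp. 288–289, (86)–(88) p. 291, Prop. 6 (117)–(120)
# p. 295 («the functions … depend analytically on U»); [Balaban1985BackgroundPropagators] (3.126) p. 420, (3.132)–(3.133) p. 422; [Balaban1985Averaging] Prop. 5 (157)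
# p. 42, Proposition 7 p. 43: **THE TWO-BACKGROUND KERNEL-COLUMN LETTERS `δθ_E`, `δθ′` OF THE GENUINE (L3) SLOT AT PRINT's `k`-TH-STEP OPERATOR ARE LATTICE-FREE**
# — the binders `hδΘE`, `hδΘ'` of this lineage's junction `B11Eq98W80TwoBackgroundLetters.norm_W80_sub_W80_le_pair` AT THE TOWER's LETTERS (`H̃_{1,k}(U)`, the chain's
# `H_{1,k}(1)`, `C_k(U)`, `C_k(1)` on the (115) carriers `∇_U`, `∇_1`; `Δ_π(U) = currentCLM φ lev₁ (∇_U)(Δ̃_{a,k} − Q_k†aQ_k)`, `Δ_π(1)` in the chain's spelling):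
# `≤ ϖ·Ξ` and `≤ ϖ′·Ξ·‖X‖`, `Ξ = 2(ε_C + a_C)(j₀ + α)Θ₂Γ + 2ΘΓ_δ + 4(ε_C + a_C)ΘΓ((ε_C + a_C)(j₀ + α)Θ₂Γ + ΘΓ_δ)`, `Θ = M_φBM_φ′dK_d(δ)`, `Γ = C₃2^d2d`,
# `Θ₂ = M_φKM_φ′dK_d(κ)`, `Γ_δ = (6α∕r′ + 24D∕ρ)(C₃ᶜρ)2^d2d` — `(α₁, j₁, B, δ, K, κ)` BEFORE the lattice, linear in `j₀ + α` and in the DISPLAYED field defect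
# `D ≥ sup_b‖(T_UP)(b) − (T_1(ιP))(b)‖`.  Composition of this lineage's bricks: the (68)-Neumann algebra on both carriers (`B11Eq73KernelColumnsTwoBackgrounds`,
# `B11Eq88KernelColumnsCompositeTwoBackgrounds`) fed by the one-block letters at `U` and at the vacuum (`B11Ineq88KernelLettersFlatChain`), the two-background one-block
# letters (`B9Eq3133H1kPiTwoBackgroundOneBlockColumn`, `B11Eq88LaplaceH1CurrentTwoBackgroundOneBlockColumn`), [4] Prop. 5 (157) for `C_k`'s kernel at `U` and at `1`
# (`B11Eq44CKernelColumnTower`) and Prop. 7 read as a kernel modulus (`B11Eq44CKernelTowerTwoBackgrounds`); `d·L^{(n+1)d}·L^{−(n+1)d} = d` and `L^{n+1}η = 1` throughout.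
# NE9 crux-team LEAF PROVER 01 (`b2b-balaban-t4-ne9-formalise-leaf-01`), gen 105; cell `pub-balaban`∕`t4`, row NE9, bears_on R4/N22; composition BY NAME; [folklore].
WHAT IS PROVED (sorry-free; 0 `def`): **`exists_kernelColumns_sub_flat_latticeFree`**.  HONEST SCOPE: composition BY NAME on the cell's MODEL rows (O-NE9-1; #5 UNRULED);
constants crude; first order at the flat point; `j₀`, `α`, `D` displayed separately; the windows, both Sect. C regimes, Prop. 7's smallness inequalities and the complex
Prop. 5 regime (`epsCplx`, `tauCplx` at `r′∕L^{n+1}`) stay HYPOTHESES; nothing of [B11] (68)–(73), (88), (117)–(120), [B9] (3.126), (3.132)–(3.133), Thm 3.4 or [B7]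
Prop. 5∕7 asserted as printed; «NE9 ⇐ the named binders»; NE9 NOT PRINTED ∕ NOT PROVED; spine PROVED 0∕9; rung (B)+1 finite T⁴ — NOT infinite volume, NOT mass gap,
NOT BetaPertH, NOT Clay.  HONEST DEPENDENCY: continuum YM on T⁴ ⇐ BetaPertH ∧ nine spine estimates (0/9 proved); BetaPertH ⇐ (D1) ∧ (D4) ∧ CAP+tail; G-an2-4 gates
asym, D1 and NE2/3/4.  NEW file; nothing modified.  Net new unproved facts: 0.
-/

noncomputable section

open scoped InnerProductSpace ComplexConjugate BigOperators

namespace Literature.MathematicalPhysics.QuantumFieldTheory.Balaban1983to89.B11Ineq88KernelColumnsTwoBackgroundLatticeFree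

open B4Sect5Torus (TSite tdist tdist_nonneg)
open B4Sect5Proof (latticeConst latticeConst_nonneg)
open B9SectCLatticeCarrier (Bond bpos shift unshift)
open B9Eq319QprimeTorus (blockCoord)
open B7Prop1Explicit (U1 Wcx boxVec)
open B11Eq103H1Complex (SiteL2K BondL2K H1LatticeCLM)
open B9Eq310DeltaPrime (plaqHolU plaqHolU_one)
open B9Eq310HessianOperator (adTransportW hessOp)
open B9Eq315QTorus (perCfg cornerSite)
open B9Eq315QTower (towerP UlevOf)
open B9Eq315QTowerFlat (perCfg_UlevOf_one_mem_U1 norm_Wcx_UlevOf_one_sub_one_le)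
open B9Eq316TowerFlatIsOneStep (towerP_eq_fineP_pow siteCast)
open B9Eq326OperatorTower (QkW laplaceAk RofUk)
open B9Eq324DeltaPrimeATower (laplacePrimeAk)
open B9Eq3119DeltaPiTower (laplaceAkPi)
open B9Eq3119DeltaPiCarrier (currentCLM)
open B9Eq3126H1kPiOneBlockColumn (sum_fine_exp_block_le sum_fine_weight_exp_block_le)
open B11Eq115Space
open B11Eq111FrakG (nabla115 jetLinearEquiv)
open B11Eq174Chart (Regime)
open B11Eq90Transpose (kernel single115)
open B11Eq80Current (Emap)
open B11Eq90V0GroupComposed (T47 norm_T47_lt)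
open B11Eq44COperatorTower (C2T)
open B11Eq44CLetterTower (Cck prop4Hyp_Cck)
open B11Eq44CKernelColumnTower (norm_fderiv_Cck_single_apply_le)
open B11Eq44CKernelTowerTwoBackgrounds (norm_fderiv_Cck_sub_flat_single_apply_le)
open B7Eq141TorusImagesCount (sum_images_kerQdd_le)
open B7Eq43AveragedSmallnessLevelFree (pdev_perCfg_le_of_plaq)
open B7Prop2Explicit (pdev AvgClosed C0 c2')
open B7Prop3Flat (c3)
open B7Prop5GeneralLevels (thetaGen C3Gen)
open B7Prop5GeneralOperators (kerQdd kerQdd_nonneg)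
open B7Prop5CplxLevels (epsCplx tauCplx C3Cplx)
open B9Eq315QTorusOnto (liftSite periodVec)
open B11Eq73KernelColumnsTwoBackgrounds (colSum_weighted_kernel_sub_le)
open B11Eq88KernelColumnsCompositeTwoBackgrounds (colSum_weighted_comp_kernel_sub_le)
open B9Eq3133H1kPiTwoBackgroundOneBlockColumn (exists_oneBlock_letter_H1LatticeCLM_sub_flat)
open B11Eq88LaplaceH1CurrentTwoBackgroundOneBlockColumn (exists_oneBlock_letter_laplaceH1_current_sub_flat)
open B11Ineq88KernelLettersFlatChain (exists_oneBlock_letters_flat_chain)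

variable {d : ℕ} (hd : 1 ≤ d) (L : ℕ) [NeZero L] (hL : 1 ≤ L) (hL2 : 2 ≤ L) (hL3 : 3 ≤ L) [Fact (0 < (L : ℝ))]
  {𝔸 : Type*} [NormedRing 𝔸] [NormedAlgebra ℂ 𝔸] [CompleteSpace 𝔸] [NormOneClass 𝔸] [StarRing 𝔸] [NormedStarGroup 𝔸] [StarModule ℂ 𝔸] [FiniteDimensional ℂ 𝔸]
  {W : Type*} [NormedAddCommGroup W] [InnerProductSpace ℂ W] [FiniteDimensional ℂ W] (φ : W ≃ₗ[ℂ] 𝔸)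
  {Mφ Mφ' : ℝ} (hMφ : 0 ≤ Mφ) (hMφ' : 0 ≤ Mφ') (hφ : ∀ w, ‖φ w‖ ≤ Mφ * ‖w‖) (hφ' : ∀ X, ‖φ.symm X‖ ≤ Mφ' * ‖X‖) (hstar : ∀ X : 𝔸, ‖star X‖ ≤ ‖X‖)
  {a : ℝ} (ha : 0 < a) {a' : ℝ} (ha' : 0 < a') {ϱ : ℝ} (hϱ0 : 0 ≤ ϱ) (hϱ1 : ϱ < 1)
  (τ : 𝔸 →ₗ[ℂ] ℂ) {Cτ : ℝ} (hτ : ∀ X, ‖τ X‖ ≤ Cτ * ‖X‖) (hCτ : 0 ≤ Cτ) {Mτ : ℝ} (hτm : ∀ X Y : 𝔸, ‖τ (X * Y)‖ ≤ Mτ * ‖X‖ * ‖Y‖) (hMτ : 0 ≤ Mτ)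
  {ρw : ℝ} (hρw : 0 ≤ ρw)
  (hτ₁ : ∀ X : 𝔸, τ (star X) = conj (τ X)) (hτ₂ : ∀ X Y : 𝔸, τ (X * Y) = τ (Y * X)) (hφτ : ∀ X Y : 𝔸, ⟪φ.symm X, φ.symm Y⟫_ℂ = τ (star X * Y))
  (AQ : ℝ)
  {ι : Type} [Fintype ι] [DecidableEq ι] (b : Module.Basis ι ℝ 𝔸) {M₂ : ℝ} (hM₂ : 0 ≤ M₂) (hrepr : ∀ (v : 𝔸) (i : ι), |b.repr v i| ≤ M₂ * ‖v‖)
  -- the `C_k` data BEFORE the lattice: [4] Prop. 2's subgroup and `α₀`, the (115)-ball radius `ρ` of `C_k` (also Prop. 5's field size), Prop. 7's polydisc radius `r′` (coarse units)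
  {Gr : Subgroup 𝔸ˣ} (hGr : AvgClosed d L Gr) {α₀ : ℝ} (hα₀ : 0 < α₀) (hα3 : C0 d * α₀ ≤ 1 / 3) (hα8 : 8 * α₀ ≤ c2' d L)
  {ρ : ℝ} (hρ0 : 0 < ρ) (hρ : Real.exp (4 * (800 * ((d : ℝ) + 1) ^ 2 * ((d : ℝ) + 4)) * α₀) * (1 + 8 * (131072 * ((d : ℝ) + 1) ^ 2) * ρ) ≤ 2)
  (hρ4 : 4 * ρ ≤ c3 d L) (hθ : 2 * d * thetaGen d L α₀ ≤ (L : ℝ) ^ 3 / 16) (hC3 : 2 * d * C3Gen d L * ρ ≤ 1)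
  {r' : ℝ} (hr' : 0 < r')
  (h7s' : Real.exp (4 * (800 * ((d : ℝ) + 1) ^ 2 * ((d : ℝ) + 4)) * α₀) * (1 + 8 * (131072 * ((d : ℝ) + 1) ^ 2) * r') ≤ 2)
  (h7c' : 2 * r' ≤ c3 d L) (h7r'1 : 409600 * ((d : ℝ) + 1) ^ 2 * r' ≤ 1)
  (h7s : Real.exp (4480 * ((d : ℝ) + 1) ^ 2 * ((d : ℝ) + 4) * α₀ + 240000 * ((d : ℝ) + 1) ^ 3 * r') * (1 + 8 * (2097152 * ((d : ℝ) + 1) ^ 2) * ρ) ≤ 2)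
  (h7c : 16 * ρ < c3 d L) (h7β : (d : ℝ) * C3Cplx d L * ρ ≤ 1)

-- deep definitional unfolding `laplaceAkPi` ↦ `laplaceALatticeK … (π†Δπ) …` in the statement (as the hosts)
set_option maxRecDepth 8192 in
set_option maxHeartbeats 6400000 in
include hd hL hL2 hL3 hMφ hMφ' hφ hφ' hstar ha ha' hϱ0 hϱ1 hτ hCτ hτm hMτ hρw hτ₁ hτ₂ hφτ hM₂ hrepr hGr hα₀ hα3 hα8 hρ0 hρ hρ4 hθ hC3 hr' h7s' h7c' h7r'1 h7s h7c h7β in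
/-- **THE TWO-BACKGROUND KERNEL-COLUMN LETTERS `δθ_E`, `δθ′` AT THE TOWER ARE LATTICE-FREE** — see the module docstring: `∃ (α₁, j₁, B, δ, K, κ)` BEFORE the lattice,
then for every lattice of the tower, every background of the cell's MODEL block (with the vacuum's witnesses), every level profile, the `C_k` data, the two Sect. C
regimes and the kernel-route windows, every `P` with `‖P‖, ‖ιP‖ < a_C` and every displayed field defect `D` of the pair `(T_UP, T_1(ιP))`: the weighted fine columns of
`kernel E′_U(P) − kernel E′_1(ιP)` and of `Δ_π(U)E′_U(P)δ_bX − Δ_π(1)E′_1(ιP)δ_bX` are `≤ ϖ·Ξ` and `≤ ϖ′·Ξ·‖X‖`, `Ξ` linear in `j₀ + α` and in `Γ_δ = (6α∕r′ + 24D∕ρ)(C₃ᶜρ)2^d2d`.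
[cite: Balaban1985Variational, (68)–(73) pp.288–289, (86)–(88) p.291, Prop. 6 (117)–(120) p.295; Balaban1985BackgroundPropagators, (3.126) p.420, (3.132)–(3.133) p.422; Balaban1985Averaging, Prop. 5 (157) p.42, Proposition 7 p.43] -/
theorem exists_kernelColumns_sub_flat_latticeFree :
    ∃ α₁ j₁ B δ K κ : ℝ, 0 < α₁ ∧ 0 < j₁ ∧ 0 ≤ B ∧ 0 < δ ∧ 0 ≤ K ∧ 0 < κ ∧
      ∀ (n : ℕ) (η : ℝ) [Fact (0 < η)] (_hηL : η * (L : ℝ) ^ (n + 1) = 1) (c₀ c₁ : ℝ) [Fact (0 < c₀)] [Fact (0 < c₁)]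
        (_hw : c₀ * ((L : ℝ) ^ (n + 1)) ^ d = c₁) (_hρ : |η| ^ d / c₀ ≤ ρw) (m : Fin d → ℕ) [∀ i, NeZero (m i)] (_hm : ∀ i, 1 ≤ m i)
        (U : Bond d (towerP L m (n + 1)) → 𝔸ˣ) (αU : ℕ → ℝ) (_hα0 : ∀ j, 0 ≤ αU j) (hα1 : ∀ j, αU j ≤ 1 / 64)
        (_hαL : ∀ j, 50 * (d + 1) * αU j * (L : ℝ) ^ d ≤ 1 / 2)
        (hU1 : ∀ (j : ℕ) (x : B7Prop1Explicit.Site d) (k : Fin d), perCfg (towerP L m (j + 1)) (UlevOf L m (n + 1) U j) x k ∈ U1 𝔸)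
        (hreg : ∀ (j : ℕ) (y : TSite d (towerP L m j)) (k : Fin d) (ρ' : Fin d → Fin L),
          ‖((Wcx L (perCfg (towerP L m (j + 1)) (UlevOf L m (n + 1) U j)) (cornerSite L y) k (boxVec L ρ') : 𝔸ˣ) : 𝔸) - 1‖ ≤ αU j)
        (εU : ℕ → ℝ) (_hεU : ∀ j, 0 ≤ εU j) (_hε1 : ∀ j, εU j ≤ 1) (_hUε : ∀ (j : ℕ) (b : Bond d (towerP L m (j + 1))), ‖(UlevOf L m (n + 1) U j b : 𝔸) - 1‖ ≤ εU j)
        (_hLb : ∀ (j : ℕ) (b : Bond d (towerP L m (j + 1))), UlevOf L m (n + 1) U j b ∈ U1 𝔸)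
        (α : ℝ) (_hα : 0 ≤ α) (_hαle : α ≤ α₁)
        (hUst : ∀ b, star (U b : 𝔸) = (((U b)⁻¹ : 𝔸ˣ) : 𝔸)) (_hUb : ∀ b, U b ∈ U1 𝔸) (_hUη : ∀ b, ‖(U b : 𝔸) - 1‖ ≤ α * η)
        (_hUw : ∀ (x : TSite d (towerP L m (n + 1))) (μ ν : Fin d), ‖(U (shift ν x, μ) : 𝔸) - (U (x, μ) : 𝔸)‖ ≤ α * η ^ 2)
        (_hpl : ∀ p : B9SectCLatticeCarrier.Plaq d (towerP L m (n + 1)), ‖(plaqHolU U p : 𝔸) - 1‖ ≤ α * η ^ 2)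
        (_hUgrad : ∀ (x : TSite d (towerP L m (n + 1))) (μ : Fin d), ‖(U (x, μ) : 𝔸) - U (unshift μ x, μ)‖ ≤ α * η ^ 2)
        (_hRlev : ∀ (j : ℕ) (b : Bond d (towerP L m (j + 1))) (w : W), ‖adTransportW φ (UlevOf L m (n + 1) U j) b w‖ ≤ ‖w‖)
        (_hεg : ∀ j < n + 1, εU j ≤ α * ϱ ^ j) (_hAQ : ∑ j ∈ Finset.range (n + 1), αU j ≤ AQ)
        (hpos' : ∀ x : SiteL2K ℂ d (towerP L m (n + 1)) c₀ W, x ≠ 0 → 0 < RCLike.re ⟪x, laplacePrimeAk L m n φ η U a' (c₁ := c₁) x⟫_ℂ)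
        (hpos : ∀ x : BondL2K ℂ d (towerP L m (n + 1)) c₀ W, x ≠ 0 →
          0 < RCLike.re ⟪x, laplaceAk L m n φ η U hL αU hα1 hU1 hreg τ (c₀ := c₀) (c₁ := c₁) a x⟫_ℂ)
        (_hc₀η : c₀ = η ^ d) (j₀ : ℝ) (_hJ : ∀ μ y, ‖B9Eq39Adjoint.J (fun μ => B9Eq33CovDerivVector.shiftEquiv μ) (fun μ y => U (y, μ)) η μ y‖ ≤ j₀) (_hj : j₀ ≤ j₁)
        (hposπ : ∀ x : BondL2K ℂ d (towerP L m (n + 1)) c₀ W, x ≠ 0 →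
          0 < RCLike.re ⟪x, laplaceAkPi L m n φ τ η U a' hpos' hL αU hα1 hU1 hreg (c₁ := c₁) a x⟫_ℂ)
        (hQ : Function.Surjective (QkW L m n φ U hL αU hα1 hU1 hreg (c₀ := c₀) (c₁ := c₁)))
        (hpos'₁ : ∀ x : SiteL2K ℂ d (towerP L m (n + 1)) c₀ W, x ≠ 0 →
          0 < RCLike.re ⟪x, laplacePrimeAk L m n φ η (fun _ : Bond d (towerP L m (n + 1)) => (1 : 𝔸ˣ)) a' (c₁ := c₁) x⟫_ℂ)
        (hpos₁ : ∀ x : BondL2K ℂ d (towerP L m (n + 1)) c₀ W, x ≠ 0 →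
          0 < RCLike.re ⟪x, laplaceAk L m n φ η (fun _ : Bond d (towerP L m (n + 1)) => (1 : 𝔸ˣ)) hL (fun _ => 0) (fun _ => by norm_num)
            (perCfg_UlevOf_one_mem_U1 L m (n + 1)) (norm_Wcx_UlevOf_one_sub_one_le L m (n + 1) (fun _ => 0) (fun _ => le_rfl)) τ
            (c₀ := c₀) (c₁ := c₁) a x⟫_ℂ)
        (hQ1 : Function.Surjective (QkW L m n φ (fun _ : Bond d (towerP L m (n + 1)) => (1 : 𝔸ˣ)) hL (fun _ => 0) (fun _ => by norm_num)
          (perCfg_UlevOf_one_mem_U1 L m (n + 1)) (norm_Wcx_UlevOf_one_sub_one_le L m (n + 1) (fun _ => 0) (fun _ => le_rfl)) (c₀ := c₀) (c₁ := c₁)))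
        (lev₀ : Bond d (towerP L m (n + 1)) → ℕ) (levB : Bond d m → ℕ) (lev₁ : Bond d (towerP L m (n + 1)) × Fin d → ℕ) (_hlev : ∀ b, n + 1 ≤ lev₀ b)
        (_hUG : ∀ (x : B7Prop1Explicit.Site d) (κ : Fin d), perCfg (towerP L m (n + 1)) U x κ ∈ Gr)
        (_h52 : pdev (perCfg (towerP L m (n + 1)) U) < α₀ * (((L : ℝ) ^ (n + 1))⁻¹) ^ 2)
        (_h7E : epsCplx d L (r' / (L : ℝ) ^ (n + 1)) (n + 1) ≤ 1 / 16)
        (_h7dX : (d : ℝ) * (epsCplx d L (r' / (L : ℝ) ^ (n + 1)) (n + 1) + tauCplx d L α₀ (n + 1) (r' / (L : ℝ) ^ (n + 1)) (n + 1)) ≤ 1 / 16)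
        (_hαr' : 6 * α ≤ r')
        {bH aC εC : ℝ} (_RC : Regime (H1LatticeCLM (L := (L : ℝ)) (η := η) (lev₀ := lev₀) (levB := levB) φ hposπ hQ lev₁ (nabla115 η U)) 0
          (Cck L m η (n + 1) U lev₀ lev₁ (nabla115 η U) levB) bH 0 (C2T d α₀) ρ 0 aC εC)
        (_RC₁ : Regime (H1LatticeCLM (L := (L : ℝ)) (η := η) (lev₀ := lev₀) (levB := levB) (c := ((η : ℂ))⁻¹)
              (R := adTransportW φ (fun _ : Bond d (towerP L m (n + 1)) => (1 : 𝔸ˣ)))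
              (S := adTransportW φ fun _ : Bond d (towerP L m (n + 1)) => (1 : 𝔸ˣ)⁻¹) (Δ₁ := hessOp φ η (fun _ : Bond d (towerP L m (n + 1)) => (1 : 𝔸ˣ)) τ)
              (Rr := RofUk L m n φ η (fun _ : Bond d (towerP L m (n + 1)) => (1 : 𝔸ˣ)))
              (Q := (QkW L m n φ (fun _ : Bond d (towerP L m (n + 1)) => (1 : 𝔸ˣ)) hL (fun _ => 0) (fun _ => by norm_num)
                (perCfg_UlevOf_one_mem_U1 L m (n + 1)) (norm_Wcx_UlevOf_one_sub_one_le L m (n + 1) (fun _ => 0) (fun _ => le_rfl)) (c₀ := c₀) (c₁ := c₁))) (a := a)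
              φ hpos₁ hQ1 lev₁ (nabla115 η (fun _ : Bond d (towerP L m (n + 1)) => (1 : 𝔸ˣ)))) 0
          (Cck L m η (n + 1) (fun _ : Bond d (towerP L m (n + 1)) => (1 : 𝔸ˣ)) lev₀ lev₁ (nabla115 η (fun _ : Bond d (towerP L m (n + 1)) => (1 : 𝔸ˣ))) levB) bH 0 (C2T d α₀) ρ 0 aC εC)
        (_haC : 0 < aC) (_hεa : 2 * (εC + aC) ≤ ρ) {ϖ : ℝ} (_hϖ0 : 0 ≤ ϖ)
        (_hϖ : ∀ bb b' : Bond d (towerP L m (n + 1)), levWeight (L : ℝ) η lev₀ 3 bb / levWeight (L : ℝ) η lev₀ 3 b' ≤ ϖ) {ϖ' : ℝ} (_hϖ'0 : 0 ≤ ϖ')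
        (_hϖ' : ∀ bb b' : Bond d (towerP L m (n + 1)), levWeight (L : ℝ) η lev₀ 3 bb / levWeight (L : ℝ) η lev₀ 1 b' ≤ ϖ')
        (_hq : (εC + aC) * (Mφ * B * Mφ' * (d * latticeConst d δ)) * (C3Gen d L * (2 ^ d * (2 * d))) ≤ 1 / 2)
        (P : Space115 (L : ℝ) η lev₀ lev₁ (nabla115 η U)) (_hP : ‖P‖ < aC)
        (_hιP : ‖(LinearMap.toContinuousLinearMap
              ((jetLinearEquiv (L : ℝ) η lev₀ lev₁ (nabla115 η (fun _ : Bond d (towerP L m (n + 1)) => (1 : 𝔸ˣ)))).symm.toLinearMap ∘ₗ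
                (jetLinearEquiv (L : ℝ) η lev₀ lev₁ (nabla115 η U)).toLinearMap)) P‖ < aC)
        {D : ℝ} (_hD0 : 0 ≤ D)
        (_hD : ∀ bd : Bond d (towerP L m (n + 1)),
          ‖JetSup.equiv (levWeight (L : ℝ) η lev₀ 1) (levWeight (L : ℝ) η lev₁ 2) (nabla115 η U)
              (T47 (H1LatticeCLM (L := (L : ℝ)) (η := η) (lev₀ := lev₀) (levB := levB) φ hposπ hQ lev₁ (nabla115 η U))
                (Cck L m η (n + 1) U lev₀ lev₁ (nabla115 η U) levB) εC P) bd -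
            JetSup.equiv (levWeight (L : ℝ) η lev₀ 1) (levWeight (L : ℝ) η lev₁ 2) (nabla115 η (fun _ : Bond d (towerP L m (n + 1)) => (1 : 𝔸ˣ)))
              (T47 (H1LatticeCLM (L := (L : ℝ)) (η := η) (lev₀ := lev₀) (levB := levB) (c := ((η : ℂ))⁻¹)
              (R := adTransportW φ (fun _ : Bond d (towerP L m (n + 1)) => (1 : 𝔸ˣ)))
              (S := adTransportW φ fun _ : Bond d (towerP L m (n + 1)) => (1 : 𝔸ˣ)⁻¹) (Δ₁ := hessOp φ η (fun _ : Bond d (towerP L m (n + 1)) => (1 : 𝔸ˣ)) τ)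
              (Rr := RofUk L m n φ η (fun _ : Bond d (towerP L m (n + 1)) => (1 : 𝔸ˣ)))
              (Q := (QkW L m n φ (fun _ : Bond d (towerP L m (n + 1)) => (1 : 𝔸ˣ)) hL (fun _ => 0) (fun _ => by norm_num)
                (perCfg_UlevOf_one_mem_U1 L m (n + 1)) (norm_Wcx_UlevOf_one_sub_one_le L m (n + 1) (fun _ => 0) (fun _ => le_rfl)) (c₀ := c₀) (c₁ := c₁))) (a := a)
              φ hpos₁ hQ1 lev₁ (nabla115 η (fun _ : Bond d (towerP L m (n + 1)) => (1 : 𝔸ˣ))))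
                (Cck L m η (n + 1) (fun _ : Bond d (towerP L m (n + 1)) => (1 : 𝔸ˣ)) lev₀ lev₁ (nabla115 η (fun _ : Bond d (towerP L m (n + 1)) => (1 : 𝔸ˣ))) levB) εC
                ((LinearMap.toContinuousLinearMap
              ((jetLinearEquiv (L : ℝ) η lev₀ lev₁ (nabla115 η (fun _ : Bond d (towerP L m (n + 1)) => (1 : 𝔸ˣ)))).symm.toLinearMap ∘ₗ
                (jetLinearEquiv (L : ℝ) η lev₀ lev₁ (nabla115 η U)).toLinearMap)) P)) bd‖ ≤ D),
        (∀ bb : Bond d (towerP L m (n + 1)), ∑ b' : Bond d (towerP L m (n + 1)), levWeight (L : ℝ) η lev₀ 3 bb / levWeight (L : ℝ) η lev₀ 3 b' *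
            ‖kernel (fderiv ℂ (Emap (H1LatticeCLM (L := (L : ℝ)) (η := η) (lev₀ := lev₀) (levB := levB) φ hposπ hQ lev₁ (nabla115 η U))
                (Cck L m η (n + 1) U lev₀ lev₁ (nabla115 η U) levB) εC) P) b' bb -
              kernel (fderiv ℂ (Emap (H1LatticeCLM (L := (L : ℝ)) (η := η) (lev₀ := lev₀) (levB := levB) (c := ((η : ℂ))⁻¹)
              (R := adTransportW φ (fun _ : Bond d (towerP L m (n + 1)) => (1 : 𝔸ˣ)))
              (S := adTransportW φ fun _ : Bond d (towerP L m (n + 1)) => (1 : 𝔸ˣ)⁻¹) (Δ₁ := hessOp φ η (fun _ : Bond d (towerP L m (n + 1)) => (1 : 𝔸ˣ)) τ)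
              (Rr := RofUk L m n φ η (fun _ : Bond d (towerP L m (n + 1)) => (1 : 𝔸ˣ)))
              (Q := (QkW L m n φ (fun _ : Bond d (towerP L m (n + 1)) => (1 : 𝔸ˣ)) hL (fun _ => 0) (fun _ => by norm_num)
                (perCfg_UlevOf_one_mem_U1 L m (n + 1)) (norm_Wcx_UlevOf_one_sub_one_le L m (n + 1) (fun _ => 0) (fun _ => le_rfl)) (c₀ := c₀) (c₁ := c₁))) (a := a)
              φ hpos₁ hQ1 lev₁ (nabla115 η (fun _ : Bond d (towerP L m (n + 1)) => (1 : 𝔸ˣ))))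
                (Cck L m η (n + 1) (fun _ : Bond d (towerP L m (n + 1)) => (1 : 𝔸ˣ)) lev₀ lev₁ (nabla115 η (fun _ : Bond d (towerP L m (n + 1)) => (1 : 𝔸ˣ))) levB) εC)
                ((LinearMap.toContinuousLinearMap
              ((jetLinearEquiv (L : ℝ) η lev₀ lev₁ (nabla115 η (fun _ : Bond d (towerP L m (n + 1)) => (1 : 𝔸ˣ)))).symm.toLinearMap ∘ₗ
                (jetLinearEquiv (L : ℝ) η lev₀ lev₁ (nabla115 η U)).toLinearMap)) P)) b' bb‖ ≤
          ϖ * (2 * (εC + aC) * ((j₀ + α) * (Mφ * K * Mφ' * (d * latticeConst d κ)) * (C3Gen d L * (2 ^ d * (2 * d)))) + (2 * ((Mφ * B * Mφ' * (d * latticeConst d δ)) * ((6 * α / r' + 24 * D / ρ) * (C3Cplx d L * ρ) * (2 ^ d * (2 * d)))) +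
              4 * (εC + aC) * ((Mφ * B * Mφ' * (d * latticeConst d δ)) * (C3Gen d L * (2 ^ d * (2 * d)))) * ((εC + aC) * ((j₀ + α) * (Mφ * K * Mφ' * (d * latticeConst d κ)) * (C3Gen d L * (2 ^ d * (2 * d)))) + (Mφ * B * Mφ' * (d * latticeConst d δ)) * ((6 * α / r' + 24 * D / ρ) * (C3Cplx d L * ρ) * (2 ^ d * (2 * d))))))) ∧
        (∀ (bb : Bond d (towerP L m (n + 1))) (X : 𝔸), ∑ b' : Bond d (towerP L m (n + 1)), levWeight (L : ℝ) η lev₀ 3 bb / levWeight (L : ℝ) η lev₀ 1 b' *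
            ‖NegSup.equiv (levWeight (L : ℝ) η lev₀ 3) 𝔸 ((currentCLM φ lev₁ (nabla115 η U)
                (laplaceAkPi L m n φ τ η U a' hpos' hL αU hα1 hU1 hreg (c₁ := c₁) a
                  - LinearMap.adjoint (QkW L m n φ U hL αU hα1 hU1 hreg (c₀ := c₀) (c₁ := c₁)) ∘ₗ
                      ((a : ℂ) • QkW L m n φ U hL αU hα1 hU1 hreg (c₀ := c₀) (c₁ := c₁))))
                (fderiv ℂ (Emap (H1LatticeCLM (L := (L : ℝ)) (η := η) (lev₀ := lev₀) (levB := levB) φ hposπ hQ lev₁ (nabla115 η U))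
                  (Cck L m η (n + 1) U lev₀ lev₁ (nabla115 η U) levB) εC) P (single115 (lev₁ := lev₁) (Dc := nabla115 η U) bb X))) b' -
              NegSup.equiv (levWeight (L : ℝ) η lev₀ 3) 𝔸 ((currentCLM φ lev₁ (nabla115 η (fun _ : Bond d (towerP L m (n + 1)) => (1 : 𝔸ˣ)))
                (laplaceAk L m n φ η (fun _ : Bond d (towerP L m (n + 1)) => (1 : 𝔸ˣ)) hL (fun _ => 0) (fun _ => by norm_num)
                    (perCfg_UlevOf_one_mem_U1 L m (n + 1)) (norm_Wcx_UlevOf_one_sub_one_le L m (n + 1) (fun _ => 0) (fun _ => le_rfl)) τ (c₀ := c₀) (c₁ := c₁) a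
                  - LinearMap.adjoint (QkW L m n φ (fun _ : Bond d (towerP L m (n + 1)) => (1 : 𝔸ˣ)) hL (fun _ => 0) (fun _ => by norm_num)
                      (perCfg_UlevOf_one_mem_U1 L m (n + 1)) (norm_Wcx_UlevOf_one_sub_one_le L m (n + 1) (fun _ => 0) (fun _ => le_rfl)) (c₀ := c₀) (c₁ := c₁)) ∘ₗ
                      ((a : ℂ) • (QkW L m n φ (fun _ : Bond d (towerP L m (n + 1)) => (1 : 𝔸ˣ)) hL (fun _ => 0) (fun _ => by norm_num)
                        (perCfg_UlevOf_one_mem_U1 L m (n + 1)) (norm_Wcx_UlevOf_one_sub_one_le L m (n + 1) (fun _ => 0) (fun _ => le_rfl)) (c₀ := c₀) (c₁ := c₁)))))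
                (fderiv ℂ (Emap (H1LatticeCLM (L := (L : ℝ)) (η := η) (lev₀ := lev₀) (levB := levB) (c := ((η : ℂ))⁻¹)
              (R := adTransportW φ (fun _ : Bond d (towerP L m (n + 1)) => (1 : 𝔸ˣ)))
              (S := adTransportW φ fun _ : Bond d (towerP L m (n + 1)) => (1 : 𝔸ˣ)⁻¹) (Δ₁ := hessOp φ η (fun _ : Bond d (towerP L m (n + 1)) => (1 : 𝔸ˣ)) τ)
              (Rr := RofUk L m n φ η (fun _ : Bond d (towerP L m (n + 1)) => (1 : 𝔸ˣ)))
              (Q := (QkW L m n φ (fun _ : Bond d (towerP L m (n + 1)) => (1 : 𝔸ˣ)) hL (fun _ => 0) (fun _ => by norm_num)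
                (perCfg_UlevOf_one_mem_U1 L m (n + 1)) (norm_Wcx_UlevOf_one_sub_one_le L m (n + 1) (fun _ => 0) (fun _ => le_rfl)) (c₀ := c₀) (c₁ := c₁))) (a := a)
              φ hpos₁ hQ1 lev₁ (nabla115 η (fun _ : Bond d (towerP L m (n + 1)) => (1 : 𝔸ˣ))))
                  (Cck L m η (n + 1) (fun _ : Bond d (towerP L m (n + 1)) => (1 : 𝔸ˣ)) lev₀ lev₁ (nabla115 η (fun _ : Bond d (towerP L m (n + 1)) => (1 : 𝔸ˣ))) levB) εC)
                  ((LinearMap.toContinuousLinearMap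
              ((jetLinearEquiv (L : ℝ) η lev₀ lev₁ (nabla115 η (fun _ : Bond d (towerP L m (n + 1)) => (1 : 𝔸ˣ)))).symm.toLinearMap ∘ₗ
                (jetLinearEquiv (L : ℝ) η lev₀ lev₁ (nabla115 η U)).toLinearMap)) P) (single115 (lev₁ := lev₁) (Dc := nabla115 η (fun _ : Bond d (towerP L m (n + 1)) => (1 : 𝔸ˣ))) bb X))) b'‖ ≤
          ϖ' * (2 * (εC + aC) * ((j₀ + α) * (Mφ * K * Mφ' * (d * latticeConst d κ)) * (C3Gen d L * (2 ^ d * (2 * d)))) + (2 * ((Mφ * B * Mφ' * (d * latticeConst d δ)) * ((6 * α / r' + 24 * D / ρ) * (C3Cplx d L * ρ) * (2 ^ d * (2 * d)))) +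
              4 * (εC + aC) * ((Mφ * B * Mφ' * (d * latticeConst d δ)) * (C3Gen d L * (2 ^ d * (2 * d)))) * ((εC + aC) * ((j₀ + α) * (Mφ * K * Mφ' * (d * latticeConst d κ)) * (C3Gen d L * (2 ^ d * (2 * d)))) + (Mφ * B * Mφ' * (d * latticeConst d δ)) * ((6 * α / r' + 24 * D / ρ) * (C3Cplx d L * ρ) * (2 ^ d * (2 * d)))))) * ‖X‖) := by
  classical
  obtain ⟨α₀', j₀', B, δ, hα₀', hj₀', hB, hδ, H0U, H0V⟩ :=
    exists_oneBlock_letters_flat_chain hd L hL hL3 φ hMφ hMφ' hφ hφ' hstar ha ha' hϱ0 hϱ1 τ hτ hCτ hτm hMτ hρw hτ₁ hτ₂ hφτ AQ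
  obtain ⟨α₃, j₃, K₃, κ₃, hα₃, hj₃, hK₃, hκ₃, HF3⟩ :=
    exists_oneBlock_letter_H1LatticeCLM_sub_flat hd L hL hL3 φ hMφ hMφ' hφ hφ' hstar ha ha' hϱ0 hϱ1 τ hτ hCτ hτm hMτ hρw hτ₁ hτ₂ hφτ AQ b hM₂ hrepr
  obtain ⟨α₅, j₅, K₅, κ₅, hα₅, hj₅, hK₅, hκ₅, HF5⟩ :=
    exists_oneBlock_letter_laplaceH1_current_sub_flat hd L hL hL3 φ hMφ hMφ' hφ hφ' hstar ha ha' hϱ0 hϱ1 τ hτ hCτ hτm hMτ hρw hτ₁ hτ₂ hφτ AQ b hM₂ hrepr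
  refine ⟨min α₀' (min α₃ α₅), min j₀' (min j₃ j₅), B, δ, max K₃ K₅, min κ₃ κ₅, lt_min hα₀' (lt_min hα₃ hα₅), lt_min hj₀' (lt_min hj₃ hj₅), hB, hδ,
    hK₃.trans (le_max_left _ _), lt_min hκ₃ hκ₅, ?_⟩
  intro n η _ hηL c₀ c₁ _ _ hw hρ' m _ hm U αU hα0 hα1 hαL hU1 hreg εU hεU hε1 hUε hLb α hα hαle hUst hUb hUη hUw hpl hUgrad hRlev hεg hAQ hpos' hpos hc₀η j₀ hJ hj
    hposπ hQ hpos'₁ hpos₁ hQ1 lev₀ levB lev₁ hlev hUG h52 h7E h7dX hαr' bH aC εC RC RC₁ haC hεa ϖ hϖ0 hϖ ϖ' hϖ'0 hϖ' hq P hP hιP D hD0 hD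
  obtain ⟨hα₀le, hα₃le, hα₅le⟩ : α ≤ α₀' ∧ α ≤ α₃ ∧ α ≤ α₅ :=
    ⟨hαle.trans (min_le_left _ _), hαle.trans ((min_le_right _ _).trans (min_le_left _ _)), hαle.trans ((min_le_right _ _).trans (min_le_right _ _))⟩
  obtain ⟨hj₀le, hj₃le, hj₅le⟩ : j₀ ≤ j₀' ∧ j₀ ≤ j₃ ∧ j₀ ≤ j₅ :=
    ⟨hj.trans (min_le_left _ _), hj.trans ((min_le_right _ _).trans (min_le_left _ _)), hj.trans ((min_le_right _ _).trans (min_le_right _ _))⟩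
  have hη0 : 0 < η := Fact.out
  have hw3 : ∀ b' : Bond d (towerP L m (n + 1)), 0 < levWeight (L : ℝ) η lev₀ 3 b' := levWeight_pos (Fact.out : 0 < (L : ℝ)) hη0 lev₀ 3
  have hw1 : ∀ b' : Bond d (towerP L m (n + 1)), 0 < levWeight (L : ℝ) η lev₀ 1 b' := levWeight_pos (Fact.out : 0 < (L : ℝ)) hη0 lev₀ 1
  have hK1 : (1 : ℝ) ≤ (L : ℝ) ^ (n + 1) := one_le_pow₀ (by exact_mod_cast hL)
  have hK0' : (0 : ℝ) < (L : ℝ) ^ (n + 1) := lt_of_lt_of_le one_pos hK1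
  have hLk : (0 : ℝ) < ((L : ℝ) ^ (n + 1)) ^ d := by positivity
  have hLη : (L : ℝ) ^ (n + 1) * η = 1 := by rw [mul_comm]; exact hηL
  have hkr' : (L : ℝ) ^ (n + 1) * (r' / (L : ℝ) ^ (n + 1)) = r' := mul_div_cancel₀ _ hK0'.ne'
  have hkρ : (L : ℝ) ^ (n + 1) * (ρ / (L : ℝ) ^ (n + 1)) = ρ := mul_div_cancel₀ _ hK0'.ne'
  have hKd0 : 0 ≤ latticeConst d δ := latticeConst_nonneg d hδ.le
  have hKκ0 : 0 ≤ latticeConst d (min κ₃ κ₅) := latticeConst_nonneg d (lt_min hκ₃ hκ₅).le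
  have hC30 : 0 ≤ C3Gen d L := by unfold C3Gen B7Prop5GeneralLevels.C1ppGen; positivity
  have hC3c0 : 0 ≤ C3Cplx d L := by unfold C3Cplx B7Prop5CplxLevels.C1ppCplx; positivity
  have hα4 : 4 * α₀ ≤ c2' d L := by linarith
  have hx : 0 ≤ j₀ + α := add_nonneg ((norm_nonneg _).trans (hJ ⟨0, hd⟩ fun _ => 0)) hα
  have hAQ0 : 0 ≤ AQ := (Finset.sum_nonneg fun j _ => hα0 j).trans hAQ
  have hs0 : 0 ≤ εC + aC := by linarith [RC.ε₄_nonneg]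
  -- the vacuum's `C_k` data: [4] Prop. 2's subgroup and (52)
  have hUG1 : ∀ (x : B7Prop1Explicit.Site d) (κ : Fin d), perCfg (towerP L m (n + 1)) (fun _ : Bond d (towerP L m (n + 1)) => (1 : 𝔸ˣ)) x κ ∈ Gr :=
    fun x κ => by rw [B9Eq315QTorus.perCfg_apply]; exact Gr.one_mem
  have h52₁ : pdev (perCfg (towerP L m (n + 1)) (fun _ : Bond d (towerP L m (n + 1)) => (1 : 𝔸ˣ))) < α₀ * (((L : ℝ) ^ (n + 1))⁻¹) ^ 2 := by
    have hp := pdev_perCfg_le_of_plaq (U := fun _ : Bond d (towerP L m (n + 1)) => (1 : 𝔸ˣ)) (fun _ => one_mem _) le_rfl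
      (fun p => by rw [plaqHolU_one, Units.val_one, sub_self, norm_zero])
    exact lt_of_le_of_lt hp (by positivity)
  have hC := prop4Hyp_Cck L m η (n + 1) U lev₀ lev₁ (nabla115 η U) levB hL2 hGr hUG hα₀ hα3 hα4 h52 hlev hρ (by linarith)
  have hC₁ := prop4Hyp_Cck L m η (n + 1) (fun _ : Bond d (towerP L m (n + 1)) => (1 : 𝔸ˣ)) lev₀ lev₁
    (nabla115 η (fun _ : Bond d (towerP L m (n + 1)) => (1 : 𝔸ˣ))) levB hL2 hGr hUG1 hα₀ hα3 hα4 h52₁ hlev hρ (by linarith)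
  -- (1) the one-block letters of `H̃_{1,k}(U)`, `H_{1,k}(1)` and of the composites (ONE pair `(B, δ)`), their fine columns
  set hk : Bond d (towerP L m (n + 1)) → Bond d m → ℝ := fun b' y =>
    Mφ * B * Mφ' * Real.exp (-(δ * tdist m (blockCoord (L ^ (n + 1)) m (siteCast (towerP_eq_fineP_pow L m (n + 1)) (bpos b'))) (bpos y))) with hhk
  have hk0 : ∀ b' y, 0 ≤ hk b' y := fun b' y => by rw [hhk]; positivity
  have HU := H0U n η hηL c₀ c₁ hw hρ' m hm U αU hα0 hα1 hαL hU1 hreg εU hεU hUε hLb α hα hα₀le hUst hUb hUη hpl hUgrad hRlev hεg hAQ hpos' hpos hc₀η j₀ hJ hj₀le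
    hposπ hQ lev₀ lev₁ (nabla115 η U) levB
  have HV := H0V hAQ0 n η hηL c₀ c₁ hw hρ' m hm hpos'₁ hpos₁ hc₀η hQ1 lev₀ lev₁ (nabla115 η (fun _ : Bond d (towerP L m (n + 1)) => (1 : 𝔸ˣ))) levB
  have hHk := fun (y : Bond d m) (Z : 𝔸) (b' : Bond d (towerP L m (n + 1))) => (HU y Z b').1
  have hHk₁ := fun (y : Bond d m) (Z : 𝔸) (b' : Bond d (towerP L m (n + 1))) => (HV y Z b').1
  have hNk₁ := fun (y : Bond d m) (Z : 𝔸) (b' : Bond d (towerP L m (n + 1))) => (HV y Z b').2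
  set ΘH : ℝ := Mφ * B * Mφ' * (d * ((L : ℝ) ^ (n + 1)) ^ d * latticeConst d δ) with hΘH
  have hΘH0 : 0 ≤ ΘH := by rw [hΘH]; positivity
  have hH1 : ∀ y, ∑ b', hk b' y ≤ ΘH := fun y => by
    rw [hΘH, hhk]
    simp only []
    rw [← Finset.mul_sum]
    exact mul_le_mul_of_nonneg_left (sum_fine_exp_block_le L n m hm hδ (bpos y)) (by positivity)
  have hsumw : ∀ {M t : ℝ}, 0 ≤ M → 0 < t → ∀ (r : Bond d (towerP L m (n + 1)) → ℝ) (v : ℝ), (∀ b', 0 ≤ r b') → (∀ b', r b' ≤ v) → ∀ y : Bond d m,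
      ∑ b', r b' * (M * Real.exp (-(t * tdist m (blockCoord (L ^ (n + 1)) m (siteCast (towerP_eq_fineP_pow L m (n + 1)) (bpos b'))) (bpos y)))) ≤
        v * (M * (d * ((L : ℝ) ^ (n + 1)) ^ d * latticeConst d t)) := by
    intro M t hM ht r v hr0 hrv y
    have h := sum_fine_weight_exp_block_le hd L n m hm ht (bpos y) (r := fun b' => r b' * M) (ϖ := v * M) (fun b' => mul_nonneg (hr0 b') hM)
      (fun b' => mul_le_mul_of_nonneg_right (hrv b') hM)
    calc _ = ∑ b', r b' * M * Real.exp (-(t * tdist m (blockCoord (L ^ (n + 1)) m (siteCast (towerP_eq_fineP_pow L m (n + 1)) (bpos b'))) (bpos y))) :=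
          Finset.sum_congr rfl fun b' _ => by ring
      _ ≤ _ := h
      _ = _ := by ring
  have hHw : ∀ (bb : Bond d (towerP L m (n + 1))) (y : Bond d m), ∑ b', levWeight (L : ℝ) η lev₀ 3 bb / levWeight (L : ℝ) η lev₀ 3 b' * hk b' y ≤ ϖ * ΘH :=
    fun bb y => by
      rw [hΘH, hhk]
      exact hsumw (by positivity) hδ _ ϖ (fun b' => div_nonneg (hw3 bb).le (hw3 b').le) (hϖ bb) y
  have hHw' : ∀ (bb : Bond d (towerP L m (n + 1))) (y : Bond d m), ∑ b', levWeight (L : ℝ) η lev₀ 3 bb / levWeight (L : ℝ) η lev₀ 1 b' * hk b' y ≤ ϖ' * ΘH :=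
    fun bb y => by
      rw [hΘH, hhk]
      exact hsumw (by positivity) hδ _ ϖ' (fun b' => div_nonneg (hw3 bb).le (hw1 b').le) (hϖ' bb) y
  -- (2) the two-background one-block letters `δhk` of `H̃_{1,k}(U) − H_{1,k}(1)` and `δhk′` of the composites (ONE pair `(K, κ)`), their fine columns
  set dk : Bond d (towerP L m (n + 1)) → Bond d m → ℝ := fun b' y =>
    (j₀ + α) * (Mφ * max K₃ K₅ * Mφ') *
      Real.exp (-(min κ₃ κ₅ * tdist m (blockCoord (L ^ (n + 1)) m (siteCast (towerP_eq_fineP_pow L m (n + 1)) (bpos b'))) (bpos y))) with hdk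
  have dk0 : ∀ b' y, 0 ≤ dk b' y := fun b' y => by rw [hdk]; positivity
  have hweak : ∀ {K₀ κ₀ : ℝ}, 0 ≤ K₀ → K₀ ≤ max K₃ K₅ → min κ₃ κ₅ ≤ κ₀ → ∀ (t : ℝ), 0 ≤ t → ∀ (z : ℝ), 0 ≤ z →
      (j₀ + α) * (Mφ * K₀ * Mφ') * Real.exp (-(κ₀ * t)) * z ≤ (j₀ + α) * (Mφ * max K₃ K₅ * Mφ') * Real.exp (-(min κ₃ κ₅ * t)) * z := by
    intro K₀ κ₀ hK₀ hKK hκκ t ht z hz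
    have h1 : Real.exp (-(κ₀ * t)) ≤ Real.exp (-(min κ₃ κ₅ * t)) := Real.exp_le_exp.2 (neg_le_neg (mul_le_mul_of_nonneg_right hκκ ht))
    have h2 : (j₀ + α) * (Mφ * K₀ * Mφ') ≤ (j₀ + α) * (Mφ * max K₃ K₅ * Mφ') :=
      mul_le_mul_of_nonneg_left (mul_le_mul_of_nonneg_right (mul_le_mul_of_nonneg_left hKK hMφ) hMφ') hx
    exact mul_le_mul_of_nonneg_right (mul_le_mul h2 h1 (Real.exp_nonneg _) (by positivity)) hz
  have hδH := fun (y : Bond d m) (Z : 𝔸) (b' : Bond d (towerP L m (n + 1))) =>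
    (HF3 n η hηL c₀ c₁ hw hρ' m hm U αU hα0 hα1 hαL hU1 hreg εU hεU hε1 hUε hLb α hα hα₃le hUst hUb hUη hUw hpl hUgrad hRlev hεg hAQ hpos' hpos hc₀η j₀ hJ
      hj₃le hposπ hQ hpos'₁ hpos₁ hQ1 lev₀ lev₁ (nabla115 η U) (nabla115 η (fun _ : Bond d (towerP L m (n + 1)) => (1 : 𝔸ˣ))) levB y Z b').trans
      (hweak hK₃ (le_max_left _ _) (min_le_left _ _) _ (tdist_nonneg _ _ _) _ (norm_nonneg Z))
  have hδN := fun (y : Bond d m) (Z : 𝔸) (b' : Bond d (towerP L m (n + 1))) =>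
    (HF5 n η hηL c₀ c₁ hw hρ' m hm U αU hα0 hα1 hαL hU1 hreg εU hεU hε1 hUε hLb α hα hα₅le hUst hUb hUη hUw hpl hUgrad hRlev hεg hAQ hpos' hpos hc₀η j₀ hJ
      hj₅le hposπ hQ hpos'₁ hpos₁ hQ1 lev₀ lev₁ (nabla115 η U) (nabla115 η (fun _ : Bond d (towerP L m (n + 1)) => (1 : 𝔸ˣ))) levB y Z b').trans
      (hweak hK₅ (le_max_right _ _) (min_le_right _ _) _ (tdist_nonneg _ _ _) _ (norm_nonneg Z))
  set δΘ : ℝ := (j₀ + α) * (Mφ * max K₃ K₅ * Mφ') * (d * ((L : ℝ) ^ (n + 1)) ^ d * latticeConst d (min κ₃ κ₅)) with hδΘ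
  have hδΘ0 : 0 ≤ δΘ := by rw [hδΘ]; positivity
  have hD1 : ∀ y, ∑ b', dk b' y ≤ δΘ := fun y => by
    rw [hδΘ, hdk]
    simp only []
    rw [← Finset.mul_sum]
    exact mul_le_mul_of_nonneg_left (sum_fine_exp_block_le L n m hm (lt_min hκ₃ hκ₅) (bpos y)) (by positivity)
  have hDw : ∀ (bb : Bond d (towerP L m (n + 1))) (y : Bond d m), ∑ b', levWeight (L : ℝ) η lev₀ 3 bb / levWeight (L : ℝ) η lev₀ 3 b' * dk b' y ≤ ϖ * δΘ :=
    fun bb y => by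
      rw [hδΘ, hdk]
      exact hsumw (by positivity) (lt_min hκ₃ hκ₅) _ ϖ (fun b' => div_nonneg (hw3 bb).le (hw3 b').le) (hϖ bb) y
  have hDw' : ∀ (bb : Bond d (towerP L m (n + 1))) (y : Bond d m), ∑ b', levWeight (L : ℝ) η lev₀ 3 bb / levWeight (L : ℝ) η lev₀ 1 b' * dk b' y ≤ ϖ' * δΘ :=
    fun bb y => by
      rw [hδΘ, hdk]
      exact hsumw (by positivity) (lt_min hκ₃ hκ₅) _ ϖ' (fun b' => div_nonneg (hw3 bb).le (hw1 b').le) (hϖ' bb) y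
  -- (3) the letters of `C_k(U)`, `C_k(1)` ([4] Prop. 5 (157), same constant) and their coarse column
  set gC : Bond d m → Bond d (towerP L m (n + 1)) → ℝ := fun c bb =>
    C3Gen d L * ∑ t ∈ (Fintype.piFinset fun _ : Fin d => ({0, 1} : Finset ℤ)),
      kerQdd L (n + 1) (liftSite c.1) c.2 (liftSite bb.1 + periodVec (towerP L m (n + 1)) t) bb.2 with hgC
  have hgC0 : ∀ c bb, 0 ≤ gC c bb := fun c bb => by
    rw [hgC]; exact mul_nonneg hC30 (Finset.sum_nonneg fun t _ => kerQdd_nonneg L (n + 1) (liftSite c.1) c.2 _ bb.2)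
  have hCg : ∀ {Dc : (Bond d (towerP L m (n + 1)) → 𝔸) →ₗ[ℂ] (Bond d (towerP L m (n + 1)) × Fin d → 𝔸)} (V : Bond d (towerP L m (n + 1)) → 𝔸ˣ)
      (_hV : ∀ (x : B7Prop1Explicit.Site d) (κ : Fin d), perCfg (towerP L m (n + 1)) V x κ ∈ Gr)
      (_h52V : pdev (perCfg (towerP L m (n + 1)) V) < α₀ * (((L : ℝ) ^ (n + 1))⁻¹) ^ 2),
      ∀ A : Space115 (L : ℝ) η lev₀ lev₁ Dc, ‖A‖ < εC + aC → ∀ (bb : Bond d (towerP L m (n + 1))) (X : 𝔸) (c : Bond d m),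
      ‖NegSup.equiv (levWeight (L : ℝ) η levB 0) 𝔸 (fderiv ℂ (Cck L m η (n + 1) V lev₀ lev₁ Dc levB) A (single115 (lev₁ := lev₁) (Dc := Dc) bb X)) c‖ ≤
        gC c bb * ‖A‖ * ‖X‖ := by
    intro Dc V hV h52V A hA bb X c
    have h := norm_fderiv_Cck_single_apply_le L m η (n + 1) V lev₀ lev₁ Dc levB hL2 hGr hV hα₀ hα3 hα4 h52V hlev hρ hρ4 hθ hC3
      (lt_of_lt_of_le hA (by linarith)) bb X c
    rw [hLη, mul_one] at h
    refine h.trans (le_of_eq ?_)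
    rw [hgC]
    simp only []
    ring
  set G : ℝ := C3Gen d L * (2 ^ d * (2 * d) * (((L : ℝ) ^ (n + 1)) ^ d)⁻¹) with hGdef
  have hG : ∀ bb, ∑ c, gC c bb ≤ G := fun bb => by
    rw [hGdef, hgC]
    simp only []
    rw [← Finset.mul_sum]
    exact mul_le_mul_of_nonneg_left (sum_images_kerQdd_le L m (n + 1) hL bb) hC30
  -- (4) the two-background entrywise letter `δg` of `𝒞′_U(T_UP) − 𝒞′_1(T_1(ιP))` ([4] Prop. 7 read as a kernel modulus) and its coarse column
  set dg : Bond d m → Bond d (towerP L m (n + 1)) → ℝ := fun c bb =>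
    (6 * α / r' + 24 * D / ρ) * (C3Cplx d L * ρ) * ∑ t ∈ (Fintype.piFinset fun _ : Fin d => ({0, 1} : Finset ℤ)),
      kerQdd L (n + 1) (liftSite c.1) c.2 (liftSite bb.1 + periodVec (towerP L m (n + 1)) t) bb.2 with hdg
  have hdg0 : ∀ c bb, 0 ≤ dg c bb := fun c bb => by
    rw [hdg]; exact mul_nonneg (by positivity) (Finset.sum_nonneg fun t _ => kerQdd_nonneg L (n + 1) (liftSite c.1) c.2 _ bb.2)
  have hY : ‖T47 (H1LatticeCLM (L := (L : ℝ)) (η := η) (lev₀ := lev₀) (levB := levB) φ hposπ hQ lev₁ (nabla115 η U))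
      (Cck L m η (n + 1) U lev₀ lev₁ (nabla115 η U) levB) εC P‖ < ρ := (norm_T47_lt RC hP).trans_le (by linarith)
  have hY' := (norm_T47_lt RC₁ hιP).le.trans (show εC + aC ≤ ρ / 2 by linarith)
  have hαρ : 6 * (α * η) ≤ r' / (L : ℝ) ^ (n + 1) := by
    rw [le_div_iff₀ hK0']; nlinarith [hαr', hLη, hη0.le, hα]
  have hconv : ∀ (bb : Bond d (towerP L m (n + 1))) (X : 𝔸) (c : Bond d m),
      (6 / ((L : ℝ) ^ (n + 1) * (r' / (L : ℝ) ^ (n + 1))) * ((L : ℝ) ^ (n + 1) * (α * η)) + 24 / (ρ / (L : ℝ) ^ (n + 1)) * (η * D)) *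
        (C3Cplx d L * ((L : ℝ) ^ (n + 1)) ^ 2 * (ρ / (L : ℝ) ^ (n + 1)) * (η * ‖X‖)) *
        (∑ t ∈ (Fintype.piFinset fun _ : Fin d => ({0, 1} : Finset ℤ)),
          kerQdd L (n + 1) (liftSite c.1) c.2 (liftSite bb.1 + periodVec (towerP L m (n + 1)) t) bb.2) = dg c bb * ‖X‖ := by
    intro bb X c
    have e1 : 6 / ((L : ℝ) ^ (n + 1) * (r' / (L : ℝ) ^ (n + 1))) * ((L : ℝ) ^ (n + 1) * (α * η)) = 6 * α / r' := by
      rw [hkr', show (L : ℝ) ^ (n + 1) * (α * η) = α * ((L : ℝ) ^ (n + 1) * η) by ring, hLη, mul_one]; ring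
    have e2 : 24 / (ρ / (L : ℝ) ^ (n + 1)) * (η * D) = 24 * D / ρ := by
      rw [div_div_eq_mul_div, show 24 * (L : ℝ) ^ (n + 1) / ρ * (η * D) = 24 * D / ρ * ((L : ℝ) ^ (n + 1) * η) by ring, hLη, mul_one]
    have e3 : C3Cplx d L * ((L : ℝ) ^ (n + 1)) ^ 2 * (ρ / (L : ℝ) ^ (n + 1)) * (η * ‖X‖) = C3Cplx d L * ρ * ‖X‖ := by
      rw [show C3Cplx d L * ((L : ℝ) ^ (n + 1)) ^ 2 * (ρ / (L : ℝ) ^ (n + 1)) * (η * ‖X‖) =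
        C3Cplx d L * ((L : ℝ) ^ (n + 1) * (ρ / (L : ℝ) ^ (n + 1))) * ((L : ℝ) ^ (n + 1) * η) * ‖X‖ by ring, hkρ, hLη, mul_one]
    rw [e1, e2, e3, hdg]
    simp only []
    ring
  have hδg := fun (bb : Bond d (towerP L m (n + 1))) (X : 𝔸) (c : Bond d m) =>
    (norm_fderiv_Cck_sub_flat_single_apply_le L m η (n + 1) U lev₀ lev₁ (nabla115 η U)
      (nabla115 η (fun _ : Bond d (towerP L m (n + 1)) => (1 : 𝔸ˣ))) levB hL2 hGr hUG hα₀ hα3 hα8 h52 hlev hρ0 hρ (ρ' := r' / (L : ℝ) ^ (n + 1)) (by positivity)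
      (by rw [hkr']; exact h7s') (by rw [hkr']; exact h7c') (by rw [hkr']; exact h7r'1) h7E h7dX (by rw [hkr', hkρ]; exact h7s) (by rw [hkρ]; exact h7c)
      (by rw [hkρ]; exact h7β) hY hY' hα hUη hαρ (δf := η * D) (by positivity) (fun bd => mul_le_mul_of_nonneg_left (hD bd) hη0.le) bb X c).trans_eq
      (hconv bb X c)
  set δG : ℝ := (6 * α / r' + 24 * D / ρ) * (C3Cplx d L * ρ) * (2 ^ d * (2 * d) * (((L : ℝ) ^ (n + 1)) ^ d)⁻¹) with hδGdef
  have hδG : ∀ bb, ∑ c, dg c bb ≤ δG := fun bb => by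
    rw [hδGdef, hdg]
    simp only []
    rw [← Finset.mul_sum]
    exact mul_le_mul_of_nonneg_left (sum_images_kerQdd_le L m (n + 1) hL bb) (by positivity)
  -- (5) the products of a fine column with a coarse column are lattice-free (`d·L^{(n+1)d}·L^{−(n+1)d} = d`)
  have hP1 : ΘH * G = (Mφ * B * Mφ' * (d * latticeConst d δ)) * (C3Gen d L * (2 ^ d * (2 * d))) := by rw [hΘH, hGdef]; field_simp
  have hP2 : δΘ * G = (j₀ + α) * (Mφ * max K₃ K₅ * Mφ' * (d * latticeConst d (min κ₃ κ₅))) * (C3Gen d L * (2 ^ d * (2 * d))) := by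
    rw [hδΘ, hGdef]; field_simp
  have hP3 : ΘH * δG = (Mφ * B * Mφ' * (d * latticeConst d δ)) * ((6 * α / r' + 24 * D / ρ) * (C3Cplx d L * ρ) * (2 ^ d * (2 * d))) := by
    rw [hΘH, hδGdef]; field_simp
  have hq' : (εC + aC) * ΘH * G ≤ 1 / 2 := by rw [mul_assoc, hP1, ← mul_assoc]; exact hq
  have hΞ : ∀ v : ℝ, 2 * (εC + aC) * (v * δΘ) * G + v * ΘH * (2 * δG + 4 * (εC + aC) * G * ((εC + aC) * δΘ * G + ΘH * δG)) =
      v * (2 * (εC + aC) * ((j₀ + α) * (Mφ * max K₃ K₅ * Mφ' * (d * latticeConst d (min κ₃ κ₅))) * (C3Gen d L * (2 ^ d * (2 * d)))) +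
        (2 * ((Mφ * B * Mφ' * (d * latticeConst d δ)) * ((6 * α / r' + 24 * D / ρ) * (C3Cplx d L * ρ) * (2 ^ d * (2 * d)))) +
          4 * (εC + aC) * ((Mφ * B * Mφ' * (d * latticeConst d δ)) * (C3Gen d L * (2 ^ d * (2 * d)))) *
            ((εC + aC) * ((j₀ + α) * (Mφ * max K₃ K₅ * Mφ' * (d * latticeConst d (min κ₃ κ₅))) * (C3Gen d L * (2 ^ d * (2 * d)))) +
              (Mφ * B * Mφ' * (d * latticeConst d δ)) * ((6 * α / r' + 24 * D / ρ) * (C3Cplx d L * ρ) * (2 ^ d * (2 * d)))))) := fun v => by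
    rw [← hP1, ← hP2, ← hP3]; ring
  -- (6) the (68)-Neumann algebra on both carriers
  refine ⟨fun bb => ?_, fun bb X => ?_⟩
  · have h := colSum_weighted_kernel_sub_le RC hC RC₁ hC₁ hk0 hHk hH1 hgC0 (hCg U hUG h52) hG hq' hk0 hHk₁ hH1 hgC0
      (hCg (fun _ : Bond d (towerP L m (n + 1)) => (1 : 𝔸ˣ)) hUG1 h52₁) hG hq' hP hιP dk0 hδH hdg0 hδg hδG hΘH0 hΘH0 hδΘ0 hD1 bb
      (r := fun b' => levWeight (L : ℝ) η lev₀ 3 bb / levWeight (L : ℝ) η lev₀ 3 b') (fun b' => div_nonneg (hw3 bb).le (hw3 b').le)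
      (by positivity) (by positivity) (hDw bb) (hHw bb)
    rw [hΞ ϖ] at h
    exact h
  · have h := colSum_weighted_comp_kernel_sub_le RC hC RC₁ hC₁ hk0 hHk hH1 hgC0 (hCg U hUG h52) hG hq' hk0 hHk₁ hH1 hgC0
      (hCg (fun _ : Bond d (towerP L m (n + 1)) => (1 : 𝔸ˣ)) hUG1 h52₁) hG hq' hP hιP dk0 hδH hdg0 hδg hδG _ _ hk0 hNk₁ dk0 hδN hΘH0 hΘH0 hδΘ0 hD1 bb
      (r := fun b' => levWeight (L : ℝ) η lev₀ 3 bb / levWeight (L : ℝ) η lev₀ 1 b') (fun b' => div_nonneg (hw3 bb).le (hw1 b').le)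
      (by positivity) (by positivity) (hDw' bb) (hHw' bb) X
    rw [hΞ ϖ'] at h
    exact h

end Literature.MathematicalPhysics.QuantumFieldTheory.Balaban1983to89.B11Ineq88KernelColumnsTwoBackgroundLatticeFree

end
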